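import Literature.NumberTheory.LFunctions.ClassTwistedZetaMeanSquare
import Literature.NumberTheory.LFunctions.ClassGroupCharacterTwist
import Literature.NumberTheory.LFunctions.IdealMoebiusCoprime
import Literature.NumberTheory.NumberFields.PrimesOverRegroup
import Mathlib.NumberTheory.SmoothNumbers
import HarnessLib

/-!
# Finite Euler products approximate the class group `L`-functions of an imaginary quadratic
# field in mean square (work in progress)
-/

noncomputable section

open scoped NumberField nonZeroDivisors
open NumberField NumberField.InfinitePlace Complex Filter Topology Set MeasureTheory
open UniqueFactorizationMonoid
open scoped Real

namespace Literature.NumberTheory.LFunctions.NumberField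

open Literature.NumberTheory.NumberFields (natPrimeUnder natPrimeUnder_prime liesOver_natPrimeUnder)

variable (K : Type*) [Field K] [NumberField K]

/-! ### The primes over the rational primes `p < P` and the finite Euler product -/

/-- The nonzero primes `𝔮` of `𝓞 K` lying over a rational prime `p < P` (all of them, whatever
their residue degree), as a `Finset`. [folklore] -/
def primesBelowIdeals (P : ℕ) : Finset (Ideal (𝓞 K)) :=
  (finite_primeIdealsLE K ((P : ℝ) ^ Module.finrank ℚ K)).toFinset.filter
    (fun Q ↦ natPrimeUnder Q < P)

variable {K}

namespace ClassEulerProduct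

omit [NumberField K] in
/-- For a nonzero prime `Q` over `q = natPrimeUnder Q`: `q ∈ Q`. [folklore] -/
theorem natCast_natPrimeUnder_mem {Q : Ideal (𝓞 K)} : ((natPrimeUnder Q : ℤ) : 𝓞 K) ∈ Q := by
  have h := (liesOver_natPrimeUnder Q).over
  have hmem : (natPrimeUnder Q : ℤ) ∈ Q.under ℤ := by
    rw [← h]; exact Ideal.mem_span_singleton_self _
  rw [Ideal.under_def, Ideal.mem_comap] at hmem
  simpa using hmem

/-- For a nonzero prime `Q` over `q`: `N(Q) ∣ q^{[K:ℚ]}`. [folklore] -/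
theorem absNorm_dvd_pow_natPrimeUnder (Q : Ideal (𝓞 K)) :
    Ideal.absNorm Q ∣ natPrimeUnder Q ^ Module.finrank ℚ K := by
  have h := Ideal.absNorm_dvd_norm_of_mem (natCast_natPrimeUnder_mem (Q := Q))
  have hnorm : Algebra.norm ℤ (((natPrimeUnder Q : ℤ) : 𝓞 K)) =
      (natPrimeUnder Q : ℤ) ^ Module.finrank ℚ K := by
    rw [show (((natPrimeUnder Q : ℤ) : 𝓞 K)) = algebraMap ℤ (𝓞 K) (natPrimeUnder Q : ℤ) by simp,
      Algebra.norm_algebraMap, ← NumberField.RingOfIntegers.rank]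
  rw [hnorm, ← Nat.cast_pow] at h
  exact Int.natCast_dvd_natCast.mp h

/-- For a nonzero prime `Q` over `q`: every prime divisor of `N(Q)` is `q`. [folklore] -/
theorem eq_natPrimeUnder_of_prime_dvd {Q : Ideal (𝓞 K)} (hQ : Q.IsPrime) (hQ0 : Q ≠ ⊥) {ℓ : ℕ}
    (hℓ : ℓ.Prime) (hdvd : ℓ ∣ Ideal.absNorm Q) : ℓ = natPrimeUnder Q := by
  have hq := natPrimeUnder_prime hQ hQ0
  have h := hdvd.trans (absNorm_dvd_pow_natPrimeUnder Q)
  exact (Nat.prime_dvd_prime_iff_eq hℓ hq).mp (hℓ.dvd_of_dvd_pow h)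

/-- For a nonzero prime `Q` over `q`: `q ∣ N(Q)` (as `N(Q) ≥ 2` is a power of `q`). [folklore] -/
theorem natPrimeUnder_dvd_absNorm {Q : Ideal (𝓞 K)} (hQ : Q.IsPrime) (hQ0 : Q ≠ ⊥) :
    natPrimeUnder Q ∣ Ideal.absNorm Q := by
  have h2 : 2 ≤ Ideal.absNorm Q :=
    two_le_absNorm_of_prime (Ideal.prime_of_isPrime hQ0 hQ)
  obtain ⟨ℓ, hℓ, hℓdvd⟩ := Nat.exists_prime_and_dvd (show Ideal.absNorm Q ≠ 1 by omega)
  rwa [eq_natPrimeUnder_of_prime_dvd hQ hQ0 hℓ hℓdvd] at hℓdvd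

/-- For a nonzero prime `Q` over `q`: `N(Q) ≤ q^{[K:ℚ]}`. [folklore] -/
theorem absNorm_le_pow_natPrimeUnder {Q : Ideal (𝓞 K)} (hQ : Q.IsPrime) (hQ0 : Q ≠ ⊥) :
    Ideal.absNorm Q ≤ natPrimeUnder Q ^ Module.finrank ℚ K :=
  Nat.le_of_dvd (pow_pos (natPrimeUnder_prime hQ hQ0).pos _) (absNorm_dvd_pow_natPrimeUnder Q)

end ClassEulerProduct

open ClassEulerProduct

/-- Membership in `primesBelowIdeals K P`: the nonzero primes over a rational prime `< P`. [folklore] -/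
theorem mem_primesBelowIdeals {P : ℕ} {Q : Ideal (𝓞 K)} :
    Q ∈ primesBelowIdeals K P ↔ Q.IsPrime ∧ Q ≠ ⊥ ∧ natPrimeUnder Q < P := by
  rw [primesBelowIdeals, Finset.mem_filter, mem_primeIdealsLE_toFinset]
  constructor
  · rintro ⟨⟨h1, h2, -⟩, h3⟩; exact ⟨h1, h2, h3⟩
  · rintro ⟨h1, h2, h3⟩
    refine ⟨⟨h1, h2, ?_⟩, h3⟩
    have h := absNorm_le_pow_natPrimeUnder h1 h2
    calc (Ideal.absNorm Q : ℝ) ≤ ((natPrimeUnder Q ^ Module.finrank ℚ K : ℕ) : ℝ) := by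
          exact_mod_cast h
      _ ≤ (P : ℝ) ^ Module.finrank ℚ K := by
          push_cast
          exact pow_le_pow_left₀ (Nat.cast_nonneg _) (by exact_mod_cast h3.le) _

/-- Every member of `primesBelowIdeals K P` is a prime element of the monoid of ideals. [folklore] -/
theorem prime_of_mem_primesBelowIdeals {P : ℕ} {Q : Ideal (𝓞 K)} (hQ : Q ∈ primesBelowIdeals K P) :
    Prime Q := by
  obtain ⟨h1, h2, -⟩ := mem_primesBelowIdeals.mp hQ
  exact Ideal.prime_of_isPrime h2 h1

/-- **`P`-smooth norms are the `primesBelowIdeals K P`-supported ideals**: for `D ≠ 0`, every prime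
factor of `D` lies over a rational prime `< P` iff `N(D)` is `P`-smooth. [folklore] -/
theorem forall_normalizedFactors_mem_iff_absNorm_mem_smoothNumbers {P : ℕ} {D : Ideal (𝓞 K)}
    (hD : D ≠ ⊥) :
    (∀ Q ∈ normalizedFactors D, Q ∈ primesBelowIdeals K P) ↔
      Ideal.absNorm D ∈ Nat.smoothNumbers P := by
  have hD0 : (D : Ideal (𝓞 K)) ≠ 0 := by rwa [Ne, Ideal.zero_eq_bot]
  have hprime : ∀ Q ∈ normalizedFactors D, Q.IsPrime ∧ Q ≠ ⊥ := fun Q hQ ↦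
    ⟨Ideal.isPrime_of_prime (prime_of_normalized_factor Q hQ),
      (prime_of_normalized_factor Q hQ).ne_zero⟩
  have hprod : Ideal.absNorm D = ((normalizedFactors D).map Ideal.absNorm).prod := by
    conv_lhs => rw [← associated_iff_eq.mp (prod_normalizedFactors hD0)]
    rw [map_multiset_prod]
  rw [Nat.mem_smoothNumbers']
  constructor
  · intro h ℓ hℓ hℓD
    rw [hprod] at hℓD
    obtain ⟨a, ha, hℓa⟩ := (Nat.prime_iff.mp hℓ).exists_mem_multiset_dvd hℓD
    rw [Multiset.mem_map] at ha
    obtain ⟨Q, hQ, rfl⟩ := ha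
    obtain ⟨hQ1, hQ2⟩ := hprime Q hQ
    rw [eq_natPrimeUnder_of_prime_dvd hQ1 hQ2 hℓ hℓa]
    exact (mem_primesBelowIdeals.mp (h Q hQ)).2.2
  · intro h Q hQ
    obtain ⟨hQ1, hQ2⟩ := hprime Q hQ
    refine mem_primesBelowIdeals.mpr ⟨hQ1, hQ2, h _ (natPrimeUnder_prime hQ1 hQ2) ?_⟩
    refine (natPrimeUnder_dvd_absNorm hQ1 hQ2).trans ?_
    exact Ideal.absNorm_dvd_absNorm_of_le (Ideal.le_of_dvd (dvd_of_mem_normalizedFactors hQ))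

/-! ### The twisted Euler product over the ideals supported on a finite set of primes -/

namespace ClassEulerProduct

/-- `((p^n : ℕ) : ℂ)^w = (((p : ℕ) : ℂ)^w)^n` (natural bases). [folklore] -/
theorem natCast_pow_cpow (p n : ℕ) (w : ℂ) : (((p ^ n : ℕ) : ℂ)) ^ w = (((p : ℕ) : ℂ) ^ w) ^ n := by
  induction n with
  | zero => simp
  | succ n ih => rw [pow_succ, Nat.cast_mul, Complex.natCast_mul_natCast_cpow, ih, pow_succ]

end ClassEulerProduct

/-- **Twisted finite Euler product over `T`-supported ideals**: for a finite set `T` of prime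
ideals, a multiplicative `ν : Ideal(𝓞 K) →*₀ ℂ` with `|ν| ≤ 1` and `Re s > 0`,
`∑_{D : supp D ⊆ T} ν(D) N(D)^{−s} = ∏_{P ∈ T} (1 − ν(P) N(P)^{−s})^{−1}` (absolutely convergent
`HasSum`; the tree's `hasSum_absNorm_rpow_neg_supported` with the character carried along).
[folklore] -/
theorem hasSum_twist_cpow_supported (ν : Ideal (𝓞 K) →*₀ ℂ) (hν : ∀ I, ‖ν I‖ ≤ 1) {s : ℂ}
    (hs : 0 < s.re) (T : Finset (Ideal (𝓞 K))) (hT : ∀ P ∈ T, Prime P) :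
    HasSum (fun D : {D : Ideal (𝓞 K) | D ≠ ⊥ ∧ ∀ Q ∈ normalizedFactors D, Q ∈ T} ↦
        ν D * ((Ideal.absNorm (D : Ideal (𝓞 K)) : ℕ) : ℂ) ^ (-s))
      (∏ P ∈ T, (1 - ν P * ((Ideal.absNorm P : ℕ) : ℂ) ^ (-s))⁻¹) := by
  classical
  induction T using Finset.induction_on with
  | empty =>
    rw [Finset.prod_empty]
    have h1 : (fun D : {D : Ideal (𝓞 K) | D ≠ ⊥ ∧ ∀ Q ∈ normalizedFactors D, Q ∈ (∅ : Finset _)} ↦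
        ν D * ((Ideal.absNorm (D : Ideal (𝓞 K)) : ℕ) : ℂ) ^ (-s)) = fun _ ↦ 1 := by
      funext D
      have hD : (D : Ideal (𝓞 K)) = ⊤ :=
        Set.mem_singleton_iff.1 ((Set.ext_iff.1 (supported_empty_eq (K := K)) D).1 D.2)
      rw [hD, Ideal.absNorm_top, Nat.cast_one, Complex.one_cpow, ← Ideal.one_eq_top, map_one, one_mul]
    rw [h1]
    have : Unique ({D : Ideal (𝓞 K) | D ≠ ⊥ ∧ ∀ Q ∈ normalizedFactors D, Q ∈ (∅ : Finset _)}) := by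
      rw [supported_empty_eq]; exact Set.uniqueSingleton ⊤
    simp
  | insert P T hPT ih =>
    have hP : Prime P := hT P (Finset.mem_insert_self _ _)
    have hT' : ∀ Q ∈ T, Prime Q := fun Q hQ ↦ hT Q (Finset.mem_insert_of_mem hQ)
    have ih' := ih hT'
    set r : ℂ := ν P * ((Ideal.absNorm P : ℕ) : ℂ) ^ (-s) with hr
    have hNP : (2 : ℝ) ≤ Ideal.absNorm P := by exact_mod_cast two_le_absNorm_of_prime hP
    have hNPpos : 0 < Ideal.absNorm P := by
      have := two_le_absNorm_of_prime hP; omega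
    have hr1 : ‖r‖ < 1 := by
      rw [hr, norm_mul, Complex.norm_natCast_cpow_of_pos hNPpos, Complex.neg_re]
      calc ‖ν P‖ * (Ideal.absNorm P : ℝ) ^ (-s.re) ≤ 1 * (Ideal.absNorm P : ℝ) ^ (-s.re) := by
            gcongr; exact hν P
        _ < 1 := by
            rw [one_mul]
            exact Real.rpow_lt_one_of_one_lt_of_neg (by linarith) (by linarith)
    have hgeom := hasSum_geometric_of_norm_lt_one hr1
    rw [Finset.prod_insert hPT]
    -- the bijection `ℕ × Supp[T] ≃ Supp[insert P T]`
    let e : ℕ × {D : Ideal (𝓞 K) | D ≠ ⊥ ∧ ∀ Q ∈ normalizedFactors D, Q ∈ T} ≃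
        {D : Ideal (𝓞 K) | D ≠ ⊥ ∧ ∀ Q ∈ normalizedFactors D, Q ∈ insert P T} :=
      { toFun := fun x ↦ ⟨P ^ x.1 * (x.2 : Ideal (𝓞 K)), pow_mul_mem_supported_insert hP x.1 x.2.2⟩
        invFun := fun D ↦ ⟨(normalizedFactors (D : Ideal (𝓞 K))).count P,
          ⟨((normalizedFactors (D : Ideal (𝓞 K))).filter (· ≠ P)).prod,
            filter_prod_mem_supported D.2⟩⟩
        left_inv := by
          rintro ⟨n, D', hD'⟩
          obtain ⟨h1, h2⟩ := count_and_filter_pow_mul hP hPT n hD'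
          ext1
          · exact h1
          · exact Subtype.ext h2
        right_inv := by
          rintro ⟨D, hD⟩
          exact Subtype.ext (pow_count_mul_filter_prod hD.1) }
    have hfun : ((fun D : {D : Ideal (𝓞 K) | D ≠ ⊥ ∧ ∀ Q ∈ normalizedFactors D, Q ∈ insert P T} ↦
        ν D * ((Ideal.absNorm (D : Ideal (𝓞 K)) : ℕ) : ℂ) ^ (-s)) ∘ e) =
        fun x : ℕ × {D : Ideal (𝓞 K) | D ≠ ⊥ ∧ ∀ Q ∈ normalizedFactors D, Q ∈ T} ↦
          r ^ x.1 * (ν x.2 * ((Ideal.absNorm (x.2 : Ideal (𝓞 K)) : ℕ) : ℂ) ^ (-s)) := by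
      funext x
      simp only [Function.comp_apply, e, Equiv.coe_fn_mk, map_mul, map_pow, Nat.cast_mul]
      rw [Complex.natCast_mul_natCast_cpow, ClassEulerProduct.natCast_pow_cpow, hr, mul_pow]
      ring
    have hsumm : Summable fun x : ℕ × {D : Ideal (𝓞 K) | D ≠ ⊥ ∧ ∀ Q ∈ normalizedFactors D, Q ∈ T} ↦
        r ^ x.1 * (ν x.2 * ((Ideal.absNorm (x.2 : Ideal (𝓞 K)) : ℕ) : ℂ) ^ (-s)) := by
      refine Summable.of_norm ?_
      have h1 : Summable fun n : ℕ ↦ ‖r‖ ^ n := summable_geometric_of_lt_one (norm_nonneg _) hr1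
      have h2 := (hasSum_absNorm_rpow_neg_supported hs T hT').summable
      refine (Summable.mul_of_nonneg h1 h2 (fun n ↦ by positivity)
        (fun D ↦ Real.rpow_nonneg (Nat.cast_nonneg _) _)).of_nonneg_of_le
        (fun x ↦ norm_nonneg _) (fun x ↦ ?_)
      have hx0 : 0 < Ideal.absNorm (x.2 : Ideal (𝓞 K)) :=
        Nat.pos_of_ne_zero (by rw [Ne, Ideal.absNorm_eq_zero_iff]; exact x.2.2.1)
      rw [norm_mul, norm_mul, norm_pow, Complex.norm_natCast_cpow_of_pos hx0, Complex.neg_re]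
      refine mul_le_mul_of_nonneg_left ?_ (by positivity)
      calc ‖ν x.2‖ * (Ideal.absNorm (x.2 : Ideal (𝓞 K)) : ℝ) ^ (-s.re)
          ≤ 1 * (Ideal.absNorm (x.2 : Ideal (𝓞 K)) : ℝ) ^ (-s.re) := by gcongr; exact hν _
        _ = _ := one_mul _
    have hmul := hgeom.mul ih' hsumm
    rw [← e.hasSum_iff, hfun]
    exact hmul

/-! ### The Dirichlet coefficients regrouped by norm -/

/-- The nonzero ideals of a given norm form a finite type. [folklore] -/
instance finite_nonZeroDivisors_absNorm_eq (n : ℕ) :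
    Finite {I : (Ideal (𝓞 K))⁰ // Ideal.absNorm (I : Ideal (𝓞 K)) = n} := by
  haveI : Finite {I : Ideal (𝓞 K) // Ideal.absNorm I = n} := (Ideal.finite_setOf_absNorm_eq n).to_subtype
  refine Finite.of_injective (fun J : {I : (Ideal (𝓞 K))⁰ // Ideal.absNorm (I : Ideal (𝓞 K)) = n} ↦
    (⟨(J.1 : Ideal (𝓞 K)), J.2⟩ : {I : Ideal (𝓞 K) // Ideal.absNorm I = n})) ?_
  rintro ⟨⟨I, hI⟩, hIn⟩ ⟨⟨I', hI'⟩, hIn'⟩ h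
  simp only [Subtype.mk.injEq] at h
  subst h
  rfl

/-- **`c_a(n) = Σ_{𝔞 ≠ 0, N𝔞 = n} a([𝔞])`** (the coefficient `Σ_C a(C) r_C(n)` as one sum over the
nonzero ideals of norm `n`). [folklore] -/
theorem classCoeff_eq_sum (a : ClassGroup (𝓞 K) → ℂ) (n : ℕ) :
    haveI := Fintype.ofFinite {I : (Ideal (𝓞 K))⁰ // Ideal.absNorm (I : Ideal (𝓞 K)) = n}
    classCoeff K a n = ∑ J : {I : (Ideal (𝓞 K))⁰ // Ideal.absNorm (I : Ideal (𝓞 K)) = n},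
      a (ClassGroup.mk0 J.1) := by
  classical
  letI := Fintype.ofFinite {I : (Ideal (𝓞 K))⁰ // Ideal.absNorm (I : Ideal (𝓞 K)) = n}
  rw [← Fintype.sum_fiberwise' (fun J : {I : (Ideal (𝓞 K))⁰ // Ideal.absNorm (I : Ideal (𝓞 K)) = n}
    ↦ ClassGroup.mk0 J.1) a, classCoeff]
  refine Finset.sum_congr rfl fun C _ ↦ ?_
  rw [Finset.sum_const, nsmul_eq_mul, mul_comm, Finset.card_univ]
  congr 2
  rw [classNormCount, ← Nat.card_eq_fintype_card]
  refine Nat.card_congr ?_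
  exact
    { toFun := fun x ↦ ⟨⟨x.1.1, x.2⟩, x.1.2⟩
      invFun := fun y ↦ ⟨⟨y.1.1, y.2⟩, y.1.2⟩
      left_inv := fun x ↦ rfl
      right_inv := fun y ↦ rfl }

/-! ### Regrouping the supported sums by norm -/

section Regroup

variable (χ : ClassGroup (𝓞 K) →* ℂˣ) (P : ℕ)

/-- Local notation: the ideals supported on the primes over the rational primes `< P`. -/
local notation3 "SuppP" =>
  {D : Ideal (𝓞 K) | D ≠ ⊥ ∧ ∀ Q ∈ normalizedFactors D, Q ∈ primesBelowIdeals K P}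

/-- A supported ideal has `P`-smooth norm. [folklore] -/
theorem absNorm_mem_smoothNumbers_of_mem (D : SuppP) :
    Ideal.absNorm (D : Ideal (𝓞 K)) ∈ Nat.smoothNumbers P :=
  (forall_normalizedFactors_mem_iff_absNorm_mem_smoothNumbers D.2.1).mp D.2.2

/-- For `P`-smooth `n`, the supported ideals of norm `n` are all the nonzero ideals of norm `n`:
an equivalence of the fibre with `{𝔞 ≠ 0 : N𝔞 = n}`. [folklore] -/
def fiberEquivOfSmooth {n : ℕ} (hn : n ∈ Nat.smoothNumbers P) :
    ((fun D : SuppP ↦ Ideal.absNorm (D : Ideal (𝓞 K))) ⁻¹' {n}) ≃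
      {I : (Ideal (𝓞 K))⁰ // Ideal.absNorm (I : Ideal (𝓞 K)) = n} where
  toFun b := ⟨⟨(b.1 : Ideal (𝓞 K)), mem_nonZeroDivisors_of_ne_zero b.1.2.1⟩, b.2⟩
  invFun J := ⟨⟨(J.1 : Ideal (𝓞 K)), ⟨nonZeroDivisors.ne_zero J.1.2,
    (forall_normalizedFactors_mem_iff_absNorm_mem_smoothNumbers (nonZeroDivisors.ne_zero J.1.2)).mpr
      (by rw [J.2]; exact hn)⟩⟩, by simp [J.2]⟩
  left_inv b := rfl
  right_inv J := rfl

/-- **Regrouping by norm.** For `g : ℕ → ℂ` such that `ν_χ(D) g(N D)` is summable over the supported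
ideals, `Σ_{D supp} ν_χ(D) g(N D) = Σ_n 1_{n smooth} c_χ(n) g(n)` (as a `HasSum` over `ℕ`), with
`c_χ = classCoeff K χ`. [folklore] -/
theorem hasSum_indicator_classCoeff (g : ℕ → ℂ)
    (hsum : Summable fun D : SuppP ↦ classGroupCharIdealHom χ D * g (Ideal.absNorm (D : Ideal (𝓞 K)))) :
    HasSum (fun n : ℕ ↦ (Nat.smoothNumbers P).indicator
        (fun n ↦ classCoeff K (fun C ↦ (χ C : ℂ)) n * g n) n)
      (∑' D : SuppP, classGroupCharIdealHom χ D * g (Ideal.absNorm (D : Ideal (𝓞 K)))) := by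
  classical
  have hfib := hsum.hasSum.tsum_fiberwise (fun D : SuppP ↦ Ideal.absNorm (D : Ideal (𝓞 K)))
  refine hfib.congr_fun fun n ↦ ?_
  -- the fibre over `n`
  by_cases hn : n ∈ Nat.smoothNumbers P
  · rw [Set.indicator_of_mem hn]
    letI := Fintype.ofFinite {I : (Ideal (𝓞 K))⁰ // Ideal.absNorm (I : Ideal (𝓞 K)) = n}
    have hterm : ∀ b : ((fun D : SuppP ↦ Ideal.absNorm (D : Ideal (𝓞 K))) ⁻¹' {n}),
        classGroupCharIdealHom χ (b.1 : Ideal (𝓞 K)) * g (Ideal.absNorm ((b.1 : SuppP) : Ideal (𝓞 K))) =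
          (χ (ClassGroup.mk0 (fiberEquivOfSmooth P hn b).1) : ℂ) * g n := by
      intro b
      have hb : Ideal.absNorm ((b.1 : SuppP) : Ideal (𝓞 K)) = n := b.2
      rw [hb, classGroupCharIdealHom_apply_of_ne_bot χ b.1.2.1]
      rfl
    rw [tsum_congr hterm, ← (fiberEquivOfSmooth P hn).symm.tsum_eq]
    simp only [Equiv.apply_symm_apply]
    rw [tsum_fintype, ← Finset.sum_mul, classCoeff_eq_sum]
  · rw [Set.indicator_of_notMem hn]
    haveI : IsEmpty ((fun D : SuppP ↦ Ideal.absNorm (D : Ideal (𝓞 K))) ⁻¹' {n}) := by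
      refine ⟨fun b ↦ hn ?_⟩
      have hb : Ideal.absNorm ((b.1 : SuppP) : Ideal (𝓞 K)) = n := b.2
      rw [← hb]
      exact absNorm_mem_smoothNumbers_of_mem P b.1
    rw [tsum_empty]

/-- The norms of `ν_χ(D) N(D)^{-s}` over the supported ideals are summable for `Re s > 0`
(majorant `N(D)^{-Re s}`, the tree's `hasSum_absNorm_rpow_neg_supported`). [folklore] -/
theorem summable_norm_twist_cpow_supported {s : ℂ} (hs : 0 < s.re) :
    Summable fun D : SuppP ↦
      ‖classGroupCharIdealHom χ D * ((Ideal.absNorm (D : Ideal (𝓞 K)) : ℕ) : ℂ) ^ (-s)‖ := by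
  have h2 := (hasSum_absNorm_rpow_neg_supported hs (primesBelowIdeals K P)
    (fun _ hQ ↦ prime_of_mem_primesBelowIdeals hQ)).summable
  refine h2.of_nonneg_of_le (fun D ↦ norm_nonneg _) (fun D ↦ ?_)
  have hD0 : 0 < Ideal.absNorm (D : Ideal (𝓞 K)) :=
    Nat.pos_of_ne_zero (by rw [Ne, Ideal.absNorm_eq_zero_iff]; exact D.2.1)
  rw [norm_mul, Complex.norm_natCast_cpow_of_pos hD0, Complex.neg_re]
  calc ‖classGroupCharIdealHom χ D‖ * (Ideal.absNorm (D : Ideal (𝓞 K)) : ℝ) ^ (-s.re)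
      ≤ 1 * (Ideal.absNorm (D : Ideal (𝓞 K)) : ℝ) ^ (-s.re) := by
        gcongr; exact norm_classGroupCharIdealHom_le χ _
    _ = _ := one_mul _

end Regroup

/-! ### The finite Euler product `Z_P(s, χ)` and its Dirichlet series -/

variable (K) in
/-- The finite Euler product over the rational primes `p < P`:
`Z_P(s, χ) = ∏_{p<P} ∏_{𝔮 ∣ p} (1 − χ([𝔮]) N𝔮^{−s})^{−1}`. [cite: Steuding2007, §1.4 (truncated Euler products), adapted] -/
def classEulerProduct (χ : ClassGroup (𝓞 K) →* ℂˣ) (P : ℕ) (s : ℂ) : ℂ :=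
  ∏ Q ∈ primesBelowIdeals K P,
    (1 - classGroupCharIdealHom χ Q * ((Ideal.absNorm Q : ℕ) : ℂ) ^ (-s))⁻¹

/-- **`Z_P(s, χ) = Σ_{n P-smooth} c_χ(n) n^{−s}`** for `Re s > 0` (`HasSum` over `ℕ` of the
indicator of the `P`-smooth numbers). [folklore] -/
theorem hasSum_indicator_classEulerProduct (χ : ClassGroup (𝓞 K) →* ℂˣ) (P : ℕ) {s : ℂ}
    (hs : 0 < s.re) :
    HasSum (fun n : ℕ ↦ (Nat.smoothNumbers P).indicator
        (fun n ↦ classCoeff K (fun C ↦ (χ C : ℂ)) n * (n : ℂ) ^ (-s)) n)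
      (classEulerProduct K χ P s) := by
  have hE := hasSum_twist_cpow_supported (classGroupCharIdealHom χ) (norm_classGroupCharIdealHom_le χ)
    hs (primesBelowIdeals K P) (fun _ hQ ↦ prime_of_mem_primesBelowIdeals hQ)
  rw [classEulerProduct, ← hE.tsum_eq]
  exact hasSum_indicator_classCoeff χ P (fun n ↦ (n : ℂ) ^ (-s))
    (summable_norm_twist_cpow_supported χ P hs).of_norm

/-! ### The supported ideals of a smooth norm and a summable majorant -/

/-- For `P`-smooth `n`, every ideal of norm `n` is nonzero and supported on the primes over the
rational primes `< P`: the two counts agree. [folklore] -/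
theorem card_supported_eq_idealNormCount (P : ℕ) {n : ℕ} (hn : n ∈ Nat.smoothNumbers P) :
    Nat.card {D : Ideal (𝓞 K) // Ideal.absNorm D = n ∧
        (D ≠ ⊥ ∧ ∀ Q ∈ normalizedFactors D, Q ∈ primesBelowIdeals K P)} = idealNormCount K n := by
  have hn0 : n ≠ 0 := (Nat.mem_smoothNumbers.mp hn).1
  rw [idealNormCount]
  refine Nat.card_congr (Equiv.subtypeEquivRight fun D ↦ ⟨fun h ↦ h.1, fun h ↦ ⟨h, ?_⟩⟩)
  have hD : D ≠ ⊥ := by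
    intro hD; rw [hD, Ideal.absNorm_bot] at h; exact hn0 h.symm
  exact ⟨hD, (forall_normalizedFactors_mem_iff_absNorm_mem_smoothNumbers hD).mpr (h ▸ hn)⟩

/-- The majorant `m(n) = #{supported D of norm n} · n^{−σ}` is summable (`σ > 0`). [folklore] -/
theorem summable_card_supported_mul_rpow (P : ℕ) {σ : ℝ} (hσ : 0 < σ) :
    Summable fun n : ℕ ↦ (Nat.card {D : Ideal (𝓞 K) // Ideal.absNorm D = n ∧
        (D ≠ ⊥ ∧ ∀ Q ∈ normalizedFactors D, Q ∈ primesBelowIdeals K P)} : ℝ) * (n : ℝ) ^ (-σ) :=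
  (hasSum_card_supported_mul_rpow hσ (primesBelowIdeals K P)
    (fun _ hQ ↦ prime_of_mem_primesBelowIdeals hQ)).summable

/-- On the `P`-smooth numbers, `|c_a(n)| n^{−σ} ≤ m(n)` for `|a| ≤ 1`; off them the indicator
vanishes. [folklore] -/
theorem indicator_norm_classCoeff_le (P : ℕ) {a : ClassGroup (𝓞 K) → ℂ} (ha : ∀ C, ‖a C‖ ≤ 1)
    (σ : ℝ) (n : ℕ) :
    (Nat.smoothNumbers P).indicator (fun n ↦ ‖classCoeff K a n‖ * (n : ℝ) ^ (-σ)) n ≤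
      (Nat.card {D : Ideal (𝓞 K) // Ideal.absNorm D = n ∧
        (D ≠ ⊥ ∧ ∀ Q ∈ normalizedFactors D, Q ∈ primesBelowIdeals K P)} : ℝ) * (n : ℝ) ^ (-σ) := by
  by_cases hn : n ∈ Nat.smoothNumbers P
  · rw [Set.indicator_of_mem hn, card_supported_eq_idealNormCount P hn]
    exact mul_le_mul_of_nonneg_right (norm_classCoeff_le ha n) (Real.rpow_nonneg (Nat.cast_nonneg _) _)
  · rw [Set.indicator_of_notMem hn]; positivity

/-- **The smooth tail `Σ_{n smooth} |c_a(n)| n^{−σ₁} (1 − e^{−n/X}) → 0` as `X → ∞`**, quantified: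
for `σ₁ > 0` and `δ > 0` there is `X₀` such that for `X ≥ X₀`, `σ ≥ σ₁`, all real `t` and all
`|a| ≤ 1`... here for the FIXED coefficient function `a` (dominated convergence with the summable
majorant `m(n)`). [folklore] -/
theorem exists_smooth_defect_le (P : ℕ) {a : ClassGroup (𝓞 K) → ℂ} (ha : ∀ C, ‖a C‖ ≤ 1)
    {σ₁ : ℝ} (hσ₁ : 0 < σ₁) {δ : ℝ} (hδ : 0 < δ) :
    ∃ X₀ : ℝ, 1 ≤ X₀ ∧ ∀ X : ℝ, X₀ ≤ X → ∀ σ : ℝ, σ₁ ≤ σ → ∀ t : ℝ,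
      ‖∑' n : ℕ, (Nat.smoothNumbers P).indicator (fun n ↦ classCoeff K a n *
        (n : ℂ) ^ (-((σ : ℂ) + t * I)) * ((Real.exp (-(n / X)) : ℂ) - 1)) n‖ ≤ δ := by
  classical
  set m : ℕ → ℝ := fun n ↦ (Nat.card {D : Ideal (𝓞 K) // Ideal.absNorm D = n ∧
      (D ≠ ⊥ ∧ ∀ Q ∈ normalizedFactors D, Q ∈ primesBelowIdeals K P)} : ℝ) * (n : ℝ) ^ (-σ₁)
    with hm
  have hmsum : Summable m := summable_card_supported_mul_rpow P hσ₁
  have hm0 : ∀ n, 0 ≤ m n := fun n ↦ by positivity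
  -- the real comparison family `f X n = m(n) (1 - e^{-n/X})`
  set f : ℝ → ℕ → ℝ := fun X n ↦ m n * (1 - Real.exp (-(n / X))) with hf
  have hf0 : ∀ X, 0 < X → ∀ n, 0 ≤ f X n := fun X hX n ↦ mul_nonneg (hm0 n)
    (by rw [sub_nonneg]; exact Real.exp_le_one_iff.mpr (by rw [neg_nonpos]; positivity))
  have hfle : ∀ X, 0 < X → ∀ n, f X n ≤ m n := fun X hX n ↦ by
    rw [hf]; exact mul_le_of_le_one_right (hm0 n) (by linarith [Real.exp_pos (-(n / X))])
  have hlim : Tendsto (fun X : ℝ ↦ ∑' n, f X n) atTop (𝓝 0) := by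
    have h := tendsto_tsum_of_dominated_convergence (𝓕 := atTop) (f := f) (g := fun _ ↦ (0 : ℝ))
      (bound := m) hmsum (fun n ↦ ?_) ?_
    · simpa using h
    · have h1 : Tendsto (fun X : ℝ ↦ -((n : ℝ) / X)) atTop (𝓝 0) := by
        have := (tendsto_const_nhds (x := (n : ℝ))).div_atTop tendsto_id
        simpa using this.neg
      have h2 : Tendsto (fun X : ℝ ↦ Real.exp (-((n : ℝ) / X))) atTop (𝓝 1) := by
        have := (Real.continuous_exp.tendsto 0).comp h1
        rw [Real.exp_zero] at this
        exact this
      have h3 : Tendsto (fun X : ℝ ↦ m n * (1 - Real.exp (-((n : ℝ) / X)))) atTop (𝓝 (m n * (1 - 1))) :=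
        (h2.const_sub 1).const_mul (m n)
      simpa [hf] using h3
    · filter_upwards [eventually_gt_atTop (0 : ℝ)] with X hX n
      rw [Real.norm_eq_abs, abs_of_nonneg (hf0 X hX n)]
      exact hfle X hX n
  have hev : ∀ᶠ X : ℝ in atTop, ∑' n, f X n < δ := (tendsto_order.1 hlim).2 δ hδ
  obtain ⟨X₁, hX₁⟩ := eventually_atTop.1 hev
  refine ⟨max X₁ 1, le_max_right _ _, fun X hX σ hσ t ↦ ?_⟩
  have hX0 : 0 < X := by linarith [le_max_right X₁ 1]
  have hXX₁ : X₁ ≤ X := le_trans (le_max_left _ _) hX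
  -- termwise bound by `f X n`
  have hterm : ∀ n : ℕ, ‖(Nat.smoothNumbers P).indicator (fun n ↦ classCoeff K a n *
      (n : ℂ) ^ (-((σ : ℂ) + t * I)) * ((Real.exp (-(n / X)) : ℂ) - 1)) n‖ ≤ f X n := by
    intro n
    by_cases hn : n ∈ Nat.smoothNumbers P
    · rw [Set.indicator_of_mem hn]
      have hn0 : n ≠ 0 := (Nat.mem_smoothNumbers.mp hn).1
      have hn1 : (1 : ℝ) ≤ n := by exact_mod_cast Nat.pos_of_ne_zero hn0
      rw [norm_mul, norm_mul, Complex.norm_natCast_cpow_of_pos (Nat.pos_of_ne_zero hn0)]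
      simp only [neg_re, add_re, ofReal_re, mul_re, I_re, mul_zero, ofReal_im, I_im, mul_one,
        sub_self, add_zero]
      have he : ‖(Real.exp (-(n / X)) : ℂ) - 1‖ = 1 - Real.exp (-(n / X)) := by
        rw [show ((Real.exp (-(n / X)) : ℂ)) - 1 = (((Real.exp (-(n / X)) - 1 : ℝ)) : ℂ) by
          push_cast; ring, Complex.norm_real, Real.norm_eq_abs, abs_of_nonpos, neg_sub]
        rw [sub_nonpos]; exact Real.exp_le_one_iff.mpr (by rw [neg_nonpos]; positivity)
      rw [he]
      have h1 := indicator_norm_classCoeff_le P ha σ₁ n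
      rw [Set.indicator_of_mem hn] at h1
      have h2 : (n : ℝ) ^ (-σ) ≤ (n : ℝ) ^ (-σ₁) := Real.rpow_le_rpow_of_exponent_le hn1 (by linarith)
      calc ‖classCoeff K a n‖ * (n : ℝ) ^ (-σ) * (1 - Real.exp (-(n / X)))
          ≤ ‖classCoeff K a n‖ * (n : ℝ) ^ (-σ₁) * (1 - Real.exp (-(n / X))) := by
            gcongr
            rw [sub_nonneg]; exact Real.exp_le_one_iff.mpr (by rw [neg_nonpos]; positivity)
        _ ≤ m n * (1 - Real.exp (-(n / X))) := by
            gcongr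
            rw [sub_nonneg]; exact Real.exp_le_one_iff.mpr (by rw [neg_nonpos]; positivity)
    · rw [Set.indicator_of_notMem hn, norm_zero]; exact hf0 X hX0 n
  have hfsum : Summable (f X) := hmsum.of_nonneg_of_le (hf0 X hX0) (hfle X hX0)
  calc ‖∑' n : ℕ, (Nat.smoothNumbers P).indicator (fun n ↦ classCoeff K a n *
        (n : ℂ) ^ (-((σ : ℂ) + t * I)) * ((Real.exp (-(n / X)) : ℂ) - 1)) n‖
      ≤ ∑' n, f X n := tsum_of_norm_bounded hfsum.hasSum hterm
    _ ≤ δ := (hX₁ X hXX₁).le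

/-! ### Mean square of a masked smoothed sum -/

/-- **Mean square of a MASKED smoothed sum** (`meanSquare_smoothedSum_le` with a set `S` of
indices): `∫_{−T}^{T} |Σ_{n∈S} c_a(n) n^{−σ₀−it} e^{−n/X}|² dt ≤ C (T · τ_S + X^{2−2σ₁+2ε})`,
`τ_S = Σ_{n ∈ S} n^{−(2σ₁−2ε)}`, uniformly in `|a| ≤ 1`, `σ₀ ≥ σ₁`, `X, T ≥ 1`.
[cite: MontgomeryVaughan1974, Corollary 3] -/
theorem meanSquare_maskedSum_le {σ₁ ε : ℝ} (hε : 0 < ε) (hσε : 1 / 2 + ε < σ₁) (hσ₁ : σ₁ < 1) :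
    ∃ C : ℝ, 0 < C ∧ ∀ (S : Set ℕ) (a : ClassGroup (𝓞 K) → ℂ), (∀ C, ‖a C‖ ≤ 1) →
      ∀ (σ₀ X T : ℝ), σ₁ ≤ σ₀ → 1 ≤ X → 1 ≤ T →
      ∫ t in (-T)..T, ‖∑' n : ℕ, S.indicator (fun n ↦ classCoeff K a n *
          (n : ℂ) ^ (-((σ₀ : ℂ) + t * I)) * (Real.exp (-(n / X)) : ℂ)) n‖ ^ 2 ≤
        C * (T * (∑' n : ℕ, S.indicator (fun n ↦ (n : ℝ) ^ (-(2 * σ₁ - 2 * ε))) n) +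
          X ^ (2 - 2 * σ₁ + 2 * ε)) := by
  classical
  obtain ⟨Cd, hCd1, hCd⟩ := exists_idealNormCount_le_rpow (K := K) hε
  have hCd0 : 0 < Cd := by linarith
  set p : ℝ := 2 * σ₁ - 2 * ε with hp
  have hp1 : 1 < p := by rw [hp]; linarith
  have hS₁sum : Summable fun n : ℕ ↦ (n : ℝ) ^ (-p) := Real.summable_nat_rpow.mpr (by linarith)
  set α : ℝ := 1 + 2 * ε - 2 * σ₁ with hα
  have hα1 : -1 < α := by rw [hα]; linarith
  have hα0 : α ≤ 0 := by rw [hα]; linarith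
  set G : ℝ := 1 + Real.Gamma (α + 1) with hG
  have hG0 : 0 < G := by
    have := Real.Gamma_pos_of_pos (by linarith : 0 < α + 1); rw [hG]; linarith
  refine ⟨Cd ^ 2 * (25 + 65 * G), by positivity, fun S a ha σ₀ X T hσ₀ hX hT ↦ ?_⟩
  have hX0 : 0 < X := by linarith
  set τ : ℝ := ∑' n : ℕ, S.indicator (fun n ↦ (n : ℝ) ^ (-p)) n with hτ
  have hτsum : Summable fun n : ℕ ↦ S.indicator (fun n ↦ (n : ℝ) ^ (-p)) n :=
    hS₁sum.indicator S
  have hτ0 : 0 ≤ τ := tsum_nonneg fun n ↦ Set.indicator_nonneg (fun n _ ↦ by positivity) n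
  -- the coefficients
  set c : ℕ → ℂ := fun n ↦ S.indicator (fun n ↦ classCoeff K a n * (n : ℂ) ^ (-(σ₀ : ℂ)) *
    (Real.exp (-(n / X)) : ℂ)) n with hc
  have hc0 : c 0 = 0 := by simp [hc, classCoeff_zero]
  have hcn : ∀ n : ℕ, n ≠ 0 → ‖c n‖ ≤
      S.indicator (fun _ ↦ (1 : ℝ)) n * (Cd * (n : ℝ) ^ (ε - σ₁) * Real.exp (-(n / X))) := by
    intro n hn
    have hnpos : 0 < (n : ℝ) := by exact_mod_cast Nat.pos_of_ne_zero hn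
    have hn1 : (1 : ℝ) ≤ n := by exact_mod_cast Nat.pos_of_ne_zero hn
    by_cases hnS : n ∈ S
    · simp only [hc, Set.indicator_of_mem hnS, norm_mul, one_mul]
      rw [Complex.norm_natCast_cpow_of_pos (Nat.pos_of_ne_zero hn), Complex.norm_real,
        Real.norm_eq_abs, abs_of_pos (Real.exp_pos _)]
      simp only [Complex.neg_re, Complex.ofReal_re]
      have h1 : ‖classCoeff K a n‖ ≤ Cd * (n : ℝ) ^ ε := (norm_classCoeff_le ha n).trans (hCd n hn)
      have hsplit : (n : ℝ) ^ (ε - σ₀) = (n : ℝ) ^ ε * (n : ℝ) ^ (-σ₀) := by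
        rw [sub_eq_add_neg, Real.rpow_add hnpos]
      calc ‖classCoeff K a n‖ * (n : ℝ) ^ (-σ₀) * Real.exp (-(n / X))
          ≤ (Cd * (n : ℝ) ^ ε) * (n : ℝ) ^ (-σ₀) * Real.exp (-(n / X)) := by gcongr
        _ = Cd * (n : ℝ) ^ (ε - σ₀) * Real.exp (-(n / X)) := by rw [hsplit]; ring
        _ ≤ Cd * (n : ℝ) ^ (ε - σ₁) * Real.exp (-(n / X)) := by gcongr
    · simp only [hc, Set.indicator_of_notMem hnS, norm_zero, zero_mul]; exact le_rfl
  have hexp_sum : ∀ κ : ℝ, 0 < κ → Summable fun n : ℕ ↦ Real.exp (-(n / κ)) := by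
    intro κ hκ
    have := Real.summable_exp_nat_mul_iff.mpr (show -(1 / κ) < 0 by rw [neg_lt_zero]; positivity)
    refine this.congr fun n ↦ ?_
    congr 1; field_simp
  have hind1 : ∀ n, S.indicator (fun _ ↦ (1 : ℝ)) n ≤ 1 := fun n ↦
    Set.indicator_le_self' (fun _ _ ↦ zero_le_one) n
  have hind0 : ∀ n, 0 ≤ S.indicator (fun _ ↦ (1 : ℝ)) n := fun n ↦
    Set.indicator_nonneg (fun _ _ ↦ zero_le_one) n
  have hsum1 : Summable fun n : ℕ ↦ ‖c n‖ := by
    refine Summable.of_nonneg_of_le (fun n ↦ norm_nonneg _) (fun n ↦ ?_)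
      ((hexp_sum X hX0).mul_left Cd)
    rcases eq_or_ne n 0 with rfl | hn
    · rw [hc0, norm_zero]; positivity
    · have hn1 : (1 : ℝ) ≤ n := by exact_mod_cast Nat.pos_of_ne_zero hn
      refine (hcn n hn).trans ?_
      have : (n : ℝ) ^ (ε - σ₁) ≤ 1 := Real.rpow_le_one_of_one_le_of_nonpos hn1 (by linarith)
      calc S.indicator (fun _ ↦ (1 : ℝ)) n * (Cd * (n : ℝ) ^ (ε - σ₁) * Real.exp (-(n / X)))
          ≤ 1 * (Cd * 1 * Real.exp (-(n / X))) := by gcongr; exact hind1 n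
        _ = Cd * Real.exp (-(n / X)) := by ring
  have hsq : ∀ n : ℕ, n ≠ 0 → ‖c n‖ ^ 2 ≤
      S.indicator (fun _ ↦ (1 : ℝ)) n * (Cd ^ 2 * ((n : ℝ) ^ (-p) * Real.exp (-(n / (X / 2))))) := by
    intro n hn
    have hnpos : 0 < (n : ℝ) := by exact_mod_cast Nat.pos_of_ne_zero hn
    have h0 : 0 ≤ Cd * (n : ℝ) ^ (ε - σ₁) * Real.exp (-(n / X)) := by positivity
    have hind_sq : (S.indicator (fun _ ↦ (1 : ℝ)) n) ^ 2 = S.indicator (fun _ ↦ (1 : ℝ)) n := by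
      by_cases hnS : n ∈ S <;> simp [hnS]
    calc ‖c n‖ ^ 2 ≤ (S.indicator (fun _ ↦ (1 : ℝ)) n * (Cd * (n : ℝ) ^ (ε - σ₁) * Real.exp (-(n / X)))) ^ 2 :=
          pow_le_pow_left₀ (norm_nonneg _) (hcn n hn) 2
      _ = S.indicator (fun _ ↦ (1 : ℝ)) n * (Cd ^ 2 * ((n : ℝ) ^ (-p) * Real.exp (-(n / (X / 2))))) := by
          have e1 : ((n : ℝ) ^ (ε - σ₁)) ^ 2 = (n : ℝ) ^ (-p) := by
            rw [← Real.rpow_natCast, ← Real.rpow_mul hnpos.le]; congr 1; rw [hp]; push_cast; ring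
          have e2 : (Real.exp (-(n / X))) ^ 2 = Real.exp (-(n / (X / 2))) := by
            rw [← Real.exp_nat_mul]; congr 1; push_cast; field_simp
          rw [mul_pow, hind_sq, mul_pow, mul_pow, e1, e2]; ring
  have hsum2 : Summable fun n : ℕ ↦ (n : ℝ) * ‖c n‖ ^ 2 := by
    refine Summable.of_nonneg_of_le (fun n ↦ by positivity) (fun n ↦ ?_)
      ((hexp_sum (X / 2) (by positivity)).mul_left (Cd ^ 2))
    rcases eq_or_ne n 0 with rfl | hn
    · simp; positivity
    · have hnpos : 0 < (n : ℝ) := by exact_mod_cast Nat.pos_of_ne_zero hn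
      have hn1 : (1 : ℝ) ≤ n := by exact_mod_cast Nat.pos_of_ne_zero hn
      calc (n : ℝ) * ‖c n‖ ^ 2
          ≤ (n : ℝ) * (S.indicator (fun _ ↦ (1 : ℝ)) n * (Cd ^ 2 * ((n : ℝ) ^ (-p) * Real.exp (-(n / (X / 2)))))) := by
            gcongr; exact hsq n hn
        _ ≤ (n : ℝ) * (1 * (Cd ^ 2 * ((n : ℝ) ^ (-p) * Real.exp (-(n / (X / 2)))))) := by
            gcongr; exact hind1 n
        _ = Cd ^ 2 * ((n : ℝ) ^ (1 - p) * Real.exp (-(n / (X / 2)))) := by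
            rw [sub_eq_add_neg, Real.rpow_add hnpos, Real.rpow_one]; ring
        _ ≤ Cd ^ 2 * (1 * Real.exp (-(n / (X / 2)))) := by
            gcongr
            exact Real.rpow_le_one_of_one_le_of_nonpos hn1 (by linarith)
        _ = Cd ^ 2 * Real.exp (-(n / (X / 2))) := by ring
  -- the mean value theorem
  have hMVT := DirichletMVT.meanSquare_tsum_shift_le hsum1 hsum2 hc0 (W := T) (by linarith) 0
  rw [zero_sub, zero_add] at hMVT
  have hint_eq : ∀ t : ℝ, (∑' n : ℕ, S.indicator (fun n ↦ classCoeff K a n *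
      (n : ℂ) ^ (-((σ₀ : ℂ) + t * I)) * (Real.exp (-(n / X)) : ℂ)) n) =
        ∑' n : ℕ, c n * (n : ℂ) ^ (-((t : ℂ) * I)) := by
    intro t
    refine tsum_congr fun n ↦ ?_
    by_cases hnS : n ∈ S
    · simp only [hc, Set.indicator_of_mem hnS]
      rcases eq_or_ne n 0 with rfl | hn
      · simp [classCoeff_zero]
      · have hn' : (n : ℂ) ≠ 0 := by exact_mod_cast hn
        rw [neg_add, Complex.cpow_add _ _ hn']
        ring
    · simp only [hc, Set.indicator_of_notMem hnS, zero_mul]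
  simp_rw [hint_eq]
  refine hMVT.trans ?_
  -- bound the coefficient sum
  have hterm_le : ∀ n : ℕ, (5 * T + 20 + 65 * (n : ℝ)) * ‖c n‖ ^ 2 ≤
      Cd ^ 2 * ((5 * T + 20) * S.indicator (fun n ↦ (n : ℝ) ^ (-p)) n) +
        Cd ^ 2 * (65 * (if n = 0 then (0 : ℝ) else (n : ℝ) ^ α * Real.exp (-(n / (X / 2))))) := by
    intro n
    rcases eq_or_ne n 0 with rfl | hn
    · have hind : 0 ≤ S.indicator (fun n ↦ (n : ℝ) ^ (-p)) 0 :=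
        Set.indicator_nonneg (fun n _ ↦ by positivity) 0
      have hT20 : 0 ≤ 5 * T + 20 := by linarith
      calc (5 * T + 20 + 65 * ((0 : ℕ) : ℝ)) * ‖c 0‖ ^ 2 = 0 := by rw [hc0, norm_zero]; ring
        _ ≤ _ := by
          rw [if_pos rfl, mul_zero, mul_zero, add_zero]
          exact mul_nonneg (sq_nonneg _) (mul_nonneg hT20 hind)
    · have hnpos : 0 < (n : ℝ) := by exact_mod_cast Nat.pos_of_ne_zero hn
      rw [if_neg hn]
      have h1 := hsq n hn
      have hexp1 : Real.exp (-(n / (X / 2))) ≤ 1 :=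
        Real.exp_le_one_iff.mpr (by rw [neg_nonpos]; positivity)
      have hnp : (n : ℝ) * ((n : ℝ) ^ (-p) * Real.exp (-(n / (X / 2)))) =
          (n : ℝ) ^ α * Real.exp (-(n / (X / 2))) := by
        rw [← mul_assoc, ← Real.rpow_one_add' hnpos.le (by rw [hp]; linarith), hp, hα]
        congr 2; ring
      have hindp : S.indicator (fun _ ↦ (1 : ℝ)) n * (n : ℝ) ^ (-p) = S.indicator (fun n ↦ (n : ℝ) ^ (-p)) n := by
        by_cases hnS : n ∈ S <;> simp [hnS]
      calc (5 * T + 20 + 65 * (n : ℝ)) * ‖c n‖ ^ 2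
          = (5 * T + 20) * ‖c n‖ ^ 2 + 65 * ((n : ℝ) * ‖c n‖ ^ 2) := by ring
        _ ≤ (5 * T + 20) * (S.indicator (fun _ ↦ (1 : ℝ)) n * (Cd ^ 2 * ((n : ℝ) ^ (-p) * Real.exp (-(n / (X / 2)))))) +
              65 * ((n : ℝ) * (S.indicator (fun _ ↦ (1 : ℝ)) n * (Cd ^ 2 * ((n : ℝ) ^ (-p) * Real.exp (-(n / (X / 2))))))) := by
            gcongr
        _ ≤ (5 * T + 20) * (S.indicator (fun _ ↦ (1 : ℝ)) n * (Cd ^ 2 * ((n : ℝ) ^ (-p) * 1))) +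
              65 * ((n : ℝ) * (1 * (Cd ^ 2 * ((n : ℝ) ^ (-p) * Real.exp (-(n / (X / 2))))))) := by
            gcongr
            · exact hind0 n
            · exact hind1 n
        _ = Cd ^ 2 * ((5 * T + 20) * (S.indicator (fun _ ↦ (1 : ℝ)) n * (n : ℝ) ^ (-p))) +
              Cd ^ 2 * (65 * ((n : ℝ) * ((n : ℝ) ^ (-p) * Real.exp (-(n / (X / 2)))))) := by ring
        _ = _ := by rw [hindp, hnp]
  have hsumA : Summable fun n : ℕ ↦ Cd ^ 2 * ((5 * T + 20) * S.indicator (fun n ↦ (n : ℝ) ^ (-p)) n) :=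
    (hτsum.mul_left (5 * T + 20)).mul_left (Cd ^ 2)
  have hB := ClassMeanSquare.tsum_rpow_mul_exp_neg_le hα1 hα0 (Y := X / 2) (by positivity)
  have hsumB0 : Summable fun n : ℕ ↦
      (if n = 0 then (0 : ℝ) else (n : ℝ) ^ α * Real.exp (-(n / (X / 2)))) := by
    refine Summable.of_nonneg_of_le (fun n ↦ ?_) (fun n ↦ ?_) (hexp_sum (X / 2) (by positivity))
    · split_ifs
      · exact le_rfl
      · positivity
    · split_ifs with hn
      · positivity
      · have hn1 : (1 : ℝ) ≤ n := by exact_mod_cast Nat.pos_of_ne_zero hn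
        calc (n : ℝ) ^ α * Real.exp (-(n / (X / 2))) ≤ 1 * Real.exp (-(n / (X / 2))) := by
              gcongr; exact Real.rpow_le_one_of_one_le_of_nonpos hn1 hα0
          _ = _ := one_mul _
  have hsumB : Summable fun n : ℕ ↦ Cd ^ 2 *
      (65 * (if n = 0 then (0 : ℝ) else (n : ℝ) ^ α * Real.exp (-(n / (X / 2))))) :=
    (hsumB0.mul_left 65).mul_left (Cd ^ 2)
  have hlhs_sum : Summable fun n : ℕ ↦ (5 * T + 20 + 65 * (n : ℝ)) * ‖c n‖ ^ 2 := by
    refine Summable.of_nonneg_of_le (fun n ↦ by positivity) hterm_le (hsumA.add hsumB)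
  calc ∑' n : ℕ, (5 * T + 20 + 65 * (n : ℝ)) * ‖c n‖ ^ 2
      ≤ ∑' n : ℕ, (Cd ^ 2 * ((5 * T + 20) * S.indicator (fun n ↦ (n : ℝ) ^ (-p)) n) +
          Cd ^ 2 * (65 * (if n = 0 then (0 : ℝ) else (n : ℝ) ^ α * Real.exp (-(n / (X / 2)))))) :=
        hlhs_sum.tsum_le_tsum hterm_le (hsumA.add hsumB)
    _ = Cd ^ 2 * ((5 * T + 20) * τ) + Cd ^ 2 * (65 *
          ∑' n : ℕ, (if n = 0 then (0 : ℝ) else (n : ℝ) ^ α * Real.exp (-(n / (X / 2))))) := by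
        rw [hsumA.tsum_add hsumB, tsum_mul_left, tsum_mul_left, tsum_mul_left, tsum_mul_left, hτ]
    _ ≤ Cd ^ 2 * ((25 * T) * τ) + Cd ^ 2 * (65 * (G * X ^ (2 - 2 * σ₁ + 2 * ε))) := by
        gcongr
        · linarith
        · refine hB.trans ?_
          rw [hG, add_mul, one_mul]
          have hX2 : (X / 2) ^ (α + 1) ≤ X ^ (2 - 2 * σ₁ + 2 * ε) := by
            rw [show α + 1 = 2 - 2 * σ₁ + 2 * ε by rw [hα]; ring]
            exact Real.rpow_le_rpow (by positivity) (by linarith) (by linarith)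
          have hX1 : (1 : ℝ) ≤ X ^ (2 - 2 * σ₁ + 2 * ε) := Real.one_le_rpow hX (by linarith)
          have := Real.Gamma_pos_of_pos (by linarith : 0 < α + 1)
          nlinarith
    _ = Cd ^ 2 * (25 + 65 * G) * (T * τ + X ^ (2 - 2 * σ₁ + 2 * ε)) -
          (Cd ^ 2 * 65 * G * T * τ + Cd ^ 2 * 25 * X ^ (2 - 2 * σ₁ + 2 * ε)) := by ring
    _ ≤ Cd ^ 2 * (25 + 65 * G) * (T * τ + X ^ (2 - 2 * σ₁ + 2 * ε)) := by
        have h1 : 0 ≤ Cd ^ 2 * 65 * G * T * τ := by positivity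
        have h2 : 0 ≤ Cd ^ 2 * 25 * X ^ (2 - 2 * σ₁ + 2 * ε) := by positivity
        linarith

/-! ### Continuity of the finite Euler product and two elementary lemmas -/

/-- `t ↦ Z_P(σ + it, χ)` is continuous for `σ > 0` (a finite product of inverses of non-vanishing
continuous factors, `|ν(𝔮)N𝔮^{−s}| < 1`). [folklore] -/
theorem continuous_classEulerProduct_vertical (χ : ClassGroup (𝓞 K) →* ℂˣ) (P : ℕ) {σ : ℝ}
    (hσ : 0 < σ) : Continuous fun t : ℝ ↦ classEulerProduct K χ P (σ + t * I) := by
  unfold classEulerProduct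
  refine continuous_finsetProd _ fun Q hQ ↦ ?_
  have hQp := prime_of_mem_primesBelowIdeals hQ
  have hN0 : 0 < Ideal.absNorm Q := by have := two_le_absNorm_of_prime hQp; omega
  have hN0' : ((Ideal.absNorm Q : ℕ) : ℂ) ≠ 0 := by exact_mod_cast hN0.ne'
  have hc : Continuous fun t : ℝ ↦ (1 : ℂ) - classGroupCharIdealHom χ Q *
      ((Ideal.absNorm Q : ℕ) : ℂ) ^ (-((σ : ℂ) + t * I)) :=
    continuous_const.sub (continuous_const.mul (Continuous.const_cpow (by fun_prop) (Or.inl hN0')))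
  refine hc.inv₀ fun t h ↦ ?_
  have hlt : ‖classGroupCharIdealHom χ Q * ((Ideal.absNorm Q : ℕ) : ℂ) ^ (-((σ : ℂ) + t * I))‖ < 1 := by
    rw [norm_mul, Complex.norm_natCast_cpow_of_pos hN0]
    simp only [neg_re, add_re, ofReal_re, mul_re, I_re, mul_zero, ofReal_im, I_im, mul_one,
      sub_self, add_zero]
    have h2 : (2 : ℝ) ≤ Ideal.absNorm Q := by exact_mod_cast two_le_absNorm_of_prime hQp
    calc ‖classGroupCharIdealHom χ Q‖ * (Ideal.absNorm Q : ℝ) ^ (-σ)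
        ≤ 1 * (Ideal.absNorm Q : ℝ) ^ (-σ) := by gcongr; exact norm_classGroupCharIdealHom_le χ Q
      _ < 1 := by rw [one_mul]; exact Real.rpow_lt_one_of_one_lt_of_neg (by linarith) (by linarith)
  rw [sub_eq_zero] at h
  rw [← h, norm_one] at hlt
  exact lt_irrefl _ hlt

namespace ClassEulerProduct

/-- If `T ≥ 1` and `T ≥ (C/δ)^{1/(1−θ)}` (`θ < 1`, `C ≥ 0`, `δ > 0`) then `C T^θ ≤ δ T`. [folklore] -/
theorem mul_rpow_le_of_threshold {C δ θ T : ℝ} (hC : 0 ≤ C) (hδ : 0 < δ) (hθ : θ < 1)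
    (hT1 : 1 ≤ T) (hT : (C / δ) ^ (1 / (1 - θ)) ≤ T) : C * T ^ θ ≤ δ * T := by
  have hT0 : 0 < T := by linarith
  have h1θ : 0 < 1 - θ := by linarith
  have hCδ : 0 ≤ C / δ := div_nonneg hC hδ.le
  have h1 : C / δ ≤ T ^ (1 - θ) := by
    calc C / δ = ((C / δ) ^ (1 / (1 - θ))) ^ (1 - θ) := by
          rw [← Real.rpow_mul hCδ, one_div_mul_cancel h1θ.ne', Real.rpow_one]
      _ ≤ T ^ (1 - θ) := Real.rpow_le_rpow (Real.rpow_nonneg hCδ _) hT h1θ.le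
  rw [div_le_iff₀ hδ] at h1
  calc C * T ^ θ ≤ (T ^ (1 - θ) * δ) * T ^ θ := by gcongr
    _ = δ * (T ^ (1 - θ) * T ^ θ) := by ring
    _ = δ * T := by rw [← Real.rpow_add hT0, sub_add_cancel, Real.rpow_one]

/-- `‖w + x − y − z‖² ≤ 4(‖w‖² + ‖x‖² + ‖y‖² + ‖z‖²)`. [folklore] -/
theorem norm_add_sub_sub_sq_le (w x y z : ℂ) :
    ‖w + x - y - z‖ ^ 2 ≤ 4 * (‖w‖ ^ 2 + ‖x‖ ^ 2 + ‖y‖ ^ 2 + ‖z‖ ^ 2) := by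
  have h1 : ‖w + x - y - z‖ ≤ ‖w‖ + ‖x‖ + ‖y‖ + ‖z‖ := by
    calc ‖w + x - y - z‖ ≤ ‖w + x - y‖ + ‖z‖ := norm_sub_le _ _
      _ ≤ ‖w + x‖ + ‖y‖ + ‖z‖ := by gcongr; exact norm_sub_le _ _
      _ ≤ ‖w‖ + ‖x‖ + ‖y‖ + ‖z‖ := by gcongr; exact norm_add_le _ _
  have h0 := norm_nonneg (w + x - y - z)
  nlinarith [norm_nonneg w, norm_nonneg x, norm_nonneg y, norm_nonneg z,
    sq_nonneg (‖w‖ - ‖x‖), sq_nonneg (‖w‖ - ‖y‖), sq_nonneg (‖w‖ - ‖z‖),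
    sq_nonneg (‖x‖ - ‖y‖), sq_nonneg (‖x‖ - ‖z‖), sq_nonneg (‖y‖ - ‖z‖)]

/-- The tails `Σ_{n ≥ P} n^{−p}` (`p > 1`) tend to `0`, quantified. [folklore] -/
theorem exists_tail_rpow_lt {p : ℝ} (hp : 1 < p) {δ : ℝ} (hδ : 0 < δ) :
    ∃ P₀ : ℕ, ∀ P : ℕ, P₀ ≤ P → ∑' n : ℕ, (Set.Ici P).indicator (fun n ↦ (n : ℝ) ^ (-p)) n < δ := by
  have hsum : Summable fun n : ℕ ↦ (n : ℝ) ^ (-p) := Real.summable_nat_rpow.mpr (by linarith)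
  have hlim : Tendsto (fun P : ℕ ↦ ∑' n : ℕ, (Set.Ici P).indicator (fun n ↦ (n : ℝ) ^ (-p)) n)
      atTop (𝓝 0) := by
    have h := tendsto_tsum_of_dominated_convergence (𝓕 := atTop)
      (f := fun (P : ℕ) (n : ℕ) ↦ (Set.Ici P).indicator (fun n ↦ (n : ℝ) ^ (-p)) n)
      (g := fun _ ↦ (0 : ℝ)) (bound := fun n : ℕ ↦ (n : ℝ) ^ (-p)) hsum (fun n ↦ ?_) ?_
    · simpa using h
    · apply tendsto_const_nhds.congr'
      filter_upwards [eventually_gt_atTop n] with P hP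
      rw [Set.indicator_of_notMem]; simpa using hP
    · refine Eventually.of_forall fun P n ↦ ?_
      rw [Real.norm_eq_abs, abs_of_nonneg (Set.indicator_nonneg (fun _ _ ↦ by positivity) _)]
      exact Set.indicator_le_self' (fun _ _ ↦ by positivity) n
  exact eventually_atTop.1 ((tendsto_order.1 hlim).2 δ hδ)

end ClassEulerProduct

/-! ### The main theorem -/

set_option maxHeartbeats 1600000 in
/-- **Finite Euler products approximate `L(s, χ)` in mean square, locally uniformly in
`1/2 < σ < 1`** (symmetric ranges): `K` imaginary quadratic, `χ` a class group character,
`1/2 < σ₁ ≤ σ₂ < 1`, `ε > 0`. There is `P₀` such that for every `P ≥ P₀` there is `T₀ ≥ 1` with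
`∫_{−T}^{T} |L(σ+it, χ) − Z_P(σ+it, χ)|² dt ≤ ε T` for all `T ≥ T₀` and `σ ∈ [σ₁, σ₂]`.
Proof: `L − Z_P = (S_X − Z_P) + E_X − Γ-term − R` with `X = T^{3/19}`, `σ' = 1/2 − (σ₁ − 1/2)/18`;
`S_X − Z_P → 0` uniformly (`exists_smooth_defect_le`), `∫|E_X|² ≤ C(T τ_P + X^{3/2−σ₁})` with
`τ_P → 0` (`meanSquare_maskedSum_le`), `∫|Γ-term|² ≪ X^{2−2σ}` and `∫|R|² ≪ X^{−2(σ−σ')}T^{1+4η}`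
(`meanSquare_remainder_le` fed by `classTwistedZeta_meanSquare_le` on the dual line `1/2 + η`).
(Karatsuba–Voronin Ch. VII §3; Steuding Thm. 4.11 for `ζ`, via Carlson's theorem — here directly.)
[cite: Steuding2007, Thm. 1.10 (proof, mean-square step) and Cor. 6.11] -/
theorem classGroupLFunction_sub_classEulerProduct_meanSquare_sym (h2 : Module.finrank ℚ K = 2)
    (hd : NumberField.discr K < 0) (χ : ClassGroup (𝓞 K) →* ℂˣ) {σ₁ σ₂ ε : ℝ}
    (hσ₁ : 1 / 2 < σ₁) (hσ₁₂ : σ₁ ≤ σ₂) (hσ₂ : σ₂ < 1) (hε : 0 < ε) :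
    ∃ P₀ : ℕ, ∀ P : ℕ, P₀ ≤ P → ∃ T₀ : ℝ, 1 ≤ T₀ ∧ ∀ T : ℝ, T₀ ≤ T →
      ∀ σ : ℝ, σ₁ ≤ σ → σ ≤ σ₂ →
        ∫ t in (-T)..T, ‖classGroupLFunction K χ (σ + t * I) -
          classEulerProduct K χ P (σ + t * I)‖ ^ 2 ≤ ε * T := by
  classical
  set a : ClassGroup (𝓞 K) → ℂ := fun C ↦ (χ C : ℂ) with ha_def
  have ha : ∀ C, ‖a C‖ ≤ 1 := fun C ↦ (norm_classGroupChar_apply χ C).le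
  have hσ₁1 : σ₁ < 1 := lt_of_le_of_lt hσ₁₂ hσ₂
  -- ### parameters
  set η : ℝ := (σ₁ - 1 / 2) / 18 with hη
  have hη0 : 0 < η := by rw [hη]; linarith
  have hη1 : η < 1 / 36 := by rw [hη]; linarith
  set σ' : ℝ := 1 / 2 - η with hσ'
  have hσ'1 : -1 / 2 ≤ σ' := by rw [hσ']; linarith
  have hσ'2 : σ' ≤ 1 / 2 := by rw [hσ']; linarith
  have hσ'0 : σ' ≠ 0 := by rw [hσ']; intro h; linarith
  have hσ₁σ' : σ₁ - σ' = 19 * η := by rw [hσ', hη]; ring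
  set q : ℝ := 3 - 4 * σ' with hq
  have hq1 : q = 1 + 4 * η := by rw [hq, hσ']; ring
  have hq0 : 0 ≤ q := by rw [hq1]; linarith
  -- ### constants
  obtain ⟨C₁, -, hC₁⟩ := classTwistedZeta_meanSquare_le h2 hd (σ₁ := 1 / 2 + η) (σ₂ := 1 / 2 + η)
    (by linarith) le_rfl (by linarith)
  have hC₁' : ∀ b : ClassGroup (𝓞 K) → ℂ, (∀ C, ‖b C‖ ≤ 1) → ∀ U : ℝ, 1 ≤ U →
      ∫ u in (-U)..U, ‖classTwistedZeta K b ((1 - σ' : ℝ) + u * I)‖ ^ 2 ≤ C₁ * U := by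
    intro b hb U hU
    have h := hC₁ b hb (1 / 2 + η) le_rfl le_rfl U hU
    have : ((1 - σ' : ℝ) : ℂ) = (((1 / 2 + η : ℝ)) : ℂ) := by rw [hσ']; push_cast; ring
    rw [this]; exact_mod_cast h
  obtain ⟨C₂, -, hC₂⟩ := meanSquare_transfer h2 hd hσ'1 hσ'2 hσ'0 hC₁'
  obtain ⟨C₃, hC₃0, hC₃⟩ := meanSquare_remainder_le (K := K) hσ'1 hσ'2 (a₁ := σ₁ - σ') (a₂ := σ₂ - σ')
    (by linarith) (by linarith) (by rw [hσ']; linarith) hq0 hC₂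
  obtain ⟨CP, hCP0, hCP⟩ := exists_meanSquare_poleTerm_le (K := K) hσ₂
  set ε₀ : ℝ := (σ₁ - 1 / 2) / 2 with hε₀
  have hε₀0 : 0 < ε₀ := by rw [hε₀]; linarith
  obtain ⟨CE, hCE0, hCE⟩ := meanSquare_maskedSum_le (K := K) hε₀0 (by rw [hε₀]; linarith) hσ₁1
  set pE : ℝ := 2 * σ₁ - 2 * ε₀ with hpE
  have hpE1 : 1 < pE := by rw [hpE, hε₀]; linarith
  -- ### the truncation `P₀`
  obtain ⟨P₀, hP₀⟩ := ClassEulerProduct.exists_tail_rpow_lt hpE1 (δ := ε / 20 / CE) (by positivity)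
  refine ⟨P₀, fun P hP ↦ ?_⟩
  have hτle : ∑' n : ℕ, (Nat.smoothNumbers P)ᶜ.indicator (fun n ↦ (n : ℝ) ^ (-pE)) n ≤ ε / 20 / CE := by
    refine le_trans ?_ (hP₀ P hP).le
    have hsum : Summable fun n : ℕ ↦ (n : ℝ) ^ (-pE) := Real.summable_nat_rpow.mpr (by linarith)
    refine (hsum.indicator _).tsum_le_tsum (fun n ↦ ?_) (hsum.indicator _)
    by_cases hn : n ∈ (Nat.smoothNumbers P)ᶜ
    · rw [Set.indicator_of_mem hn]
      rcases eq_or_ne n 0 with rfl | hn0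
      · simp [Real.zero_rpow (by linarith : -pE ≠ 0)]
        exact Set.indicator_nonneg (fun _ _ ↦ by positivity) _
      · have hnP : n ∈ Set.Ici P := by
          rw [Set.mem_Ici]
          by_contra hlt
          push Not at hlt
          apply hn
          rw [Nat.mem_smoothNumbers']
          intro ℓ hℓ hℓn
          exact lt_of_le_of_lt (Nat.le_of_dvd (Nat.pos_of_ne_zero hn0) hℓn) hlt
        rw [Set.indicator_of_mem hnP]
    · rw [Set.indicator_of_notMem hn]
      exact Set.indicator_nonneg (fun _ _ ↦ by positivity) _
  -- ### the smooth defect and `T₀`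
  set δ₁ : ℝ := min 1 (ε / 40) with hδ₁
  have hδ₁0 : 0 < δ₁ := lt_min one_pos (by positivity)
  have hδ₁sq : δ₁ ^ 2 ≤ ε / 40 := by
    have h1 : δ₁ ≤ 1 := min_le_left _ _
    have h2 : δ₁ ≤ ε / 40 := min_le_right _ _
    nlinarith
  obtain ⟨X₀, hX₀1, hX₀⟩ := exists_smooth_defect_le (K := K) P ha (by linarith : 0 < σ₁) hδ₁0
  set T₀ : ℝ := max (max 1 (X₀ ^ (19 / 3 : ℝ)))
    (max ((4 * CP / (ε / 20)) ^ (1 / (1 - 3 / 19 : ℝ)))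
      (max ((4 * CE / (ε / 20)) ^ (1 / (1 - 3 / 19 : ℝ)))
        ((4 * C₃ / (ε / 20)) ^ (1 / (1 - (1 - 2 * η)))))) with hT₀
  refine ⟨T₀, le_trans (le_max_left _ _) (le_max_left _ _), fun T hT σ hσ1 hσ2 ↦ ?_⟩
  have hT1 : 1 ≤ T := le_trans (le_trans (le_max_left _ _) (le_max_left _ _)) hT
  have hT0 : 0 < T := by linarith
  have hTT : -T ≤ T := by linarith
  have hTX₀ : X₀ ^ (19 / 3 : ℝ) ≤ T := le_trans (le_trans (le_max_right _ _) (le_max_left _ _)) hT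
  have hTP : (4 * CP / (ε / 20)) ^ (1 / (1 - 3 / 19 : ℝ)) ≤ T :=
    le_trans (le_trans (le_max_left _ _) (le_max_right _ _)) hT
  have hTE : (4 * CE / (ε / 20)) ^ (1 / (1 - 3 / 19 : ℝ)) ≤ T :=
    le_trans (le_trans (le_trans (le_max_left _ _) (le_max_right _ _)) (le_max_right _ _)) hT
  have hTR : (4 * C₃ / (ε / 20)) ^ (1 / (1 - (1 - 2 * η))) ≤ T :=
    le_trans (le_trans (le_trans (le_max_right _ _) (le_max_right _ _)) (le_max_right _ _)) hT
  -- `X = T^{3/19}`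
  set X : ℝ := T ^ (3 / 19 : ℝ) with hX
  have hX1 : 1 ≤ X := Real.one_le_rpow hT1 (by norm_num)
  have hX0 : 0 < X := by linarith
  have hXX₀ : X₀ ≤ X := by
    have h : (X₀ ^ (19 / 3 : ℝ)) ^ (3 / 19 : ℝ) ≤ T ^ (3 / 19 : ℝ) :=
      Real.rpow_le_rpow (by positivity) hTX₀ (by norm_num)
    rw [← Real.rpow_mul (by linarith), show (19 / 3 : ℝ) * (3 / 19) = 1 by norm_num,
      Real.rpow_one] at h
    exact h
  have hXT : X ≤ T := by
    calc X = T ^ (3 / 19 : ℝ) := rfl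
      _ ≤ T ^ (1 : ℝ) := Real.rpow_le_rpow_of_exponent_le hT1 (by norm_num)
      _ = T := Real.rpow_one T
  -- the shift `a' = σ - σ'`
  set a' : ℝ := σ - σ' with ha'
  have ha'0 : 0 < a' := by rw [ha', hσ']; linarith
  have ha'1 : a' < 1 := by rw [ha', hσ']; linarith
  have hs : ∀ t : ℝ, ((σ' + a' : ℝ) : ℂ) + t * I = (σ : ℂ) + t * I := fun t ↦ by
    rw [ha']; push_cast; ring
  -- ### the functions of `t`
  set c : ℕ → ℂ := classCoeff K a with hc
  set Lf : ℝ → ℂ := fun t ↦ classTwistedZeta K a (σ + t * I) with hLf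
  have hLf : ∀ t : ℝ, classGroupLFunction K χ (σ + t * I) = Lf t := fun t ↦
    classGroupLFunction_eq_classTwistedZeta χ _
  set ZP : ℝ → ℂ := fun t ↦ classEulerProduct K χ P (σ + t * I) with hZP
  set D : ℝ → ℂ := fun t ↦ ∑' n : ℕ, c n * (n : ℂ) ^ (-((σ : ℂ) + t * I)) *
    (Real.exp (-(n / X)) : ℂ) with hD
  set S : ℝ → ℂ := fun t ↦ ∑' n : ℕ, (Nat.smoothNumbers P).indicator (fun n ↦ c n *
    (n : ℂ) ^ (-((σ : ℂ) + t * I)) * (Real.exp (-(n / X)) : ℂ)) n with hS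
  set E : ℝ → ℂ := fun t ↦ ∑' n : ℕ, (Nat.smoothNumbers P)ᶜ.indicator (fun n ↦ c n *
    (n : ℂ) ^ (-((σ : ℂ) + t * I)) * (Real.exp (-(n / X)) : ℂ)) n with hE
  set Df : ℝ → ℂ := fun t ↦ ∑' n : ℕ, (Nat.smoothNumbers P).indicator (fun n ↦ c n *
    (n : ℂ) ^ (-((σ : ℂ) + t * I)) * ((Real.exp (-(n / X)) : ℂ) - 1)) n with hDf
  set Pole : ℝ → ℂ := fun t ↦ classTwistedZeta₁ K a 1 * Complex.Gamma (1 - ((σ : ℂ) + t * I)) *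
    (X : ℂ) ^ (1 - ((σ : ℂ) + t * I)) with hPole
  set Rint : ℝ → ℂ := fun t ↦ (1 / (2 * π) : ℂ) * ∫ y : ℝ,
    classTwistedZeta K a ((σ : ℂ) + t * I + ((-a' : ℝ) + y * I)) *
      Complex.Gamma ((-a' : ℝ) + y * I) * (X : ℂ) ^ (((-a' : ℝ) : ℂ) + y * I) with hRint
  -- ### the identities
  -- summability of the full smoothed series at each `t`
  have hsumm : ∀ t : ℝ, Summable fun n : ℕ ↦ c n * (n : ℂ) ^ (-((σ : ℂ) + t * I)) *
      (Real.exp (-(n / X)) : ℂ) := by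
    intro t
    obtain ⟨Cd, hCd1, hCd⟩ := exists_idealNormCount_le_rpow (K := K) one_pos
    have hsum : Summable fun n : ℕ ↦ Cd * ((n : ℝ) ^ (1 : ℕ) * Real.exp (-(1 / X) * n)) :=
      (Real.summable_pow_mul_exp_neg_nat_mul 1 (by positivity)).mul_left Cd
    refine Summable.of_norm_bounded hsum (fun n ↦ ?_)
    rcases eq_or_ne n 0 with rfl | hn
    · simp [hc, classCoeff_zero]
    · have hn1 : (1 : ℝ) ≤ n := by exact_mod_cast Nat.pos_of_ne_zero hn
      rw [norm_mul, norm_mul, Complex.norm_natCast_cpow_of_pos (Nat.pos_of_ne_zero hn),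
        Complex.norm_real, Real.norm_eq_abs, abs_of_pos (Real.exp_pos _)]
      simp only [neg_re, add_re, ofReal_re, mul_re, I_re, mul_zero, ofReal_im, I_im, mul_one,
        sub_self, add_zero]
      have h1 : ‖classCoeff K a n‖ ≤ Cd * (n : ℝ) ^ (1 : ℝ) :=
        (norm_classCoeff_le ha n).trans (hCd n hn)
      rw [Real.rpow_one] at h1
      have h2 : (n : ℝ) ^ (-σ) ≤ 1 := Real.rpow_le_one_of_one_le_of_nonpos hn1 (by linarith)
      have h3 : Real.exp (-(n / X)) = Real.exp (-(1 / X) * n) := by congr 1; field_simp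
      calc ‖c n‖ * (n : ℝ) ^ (-σ) * Real.exp (-(n / X))
          ≤ (Cd * n) * 1 * Real.exp (-(n / X)) := by rw [hc]; gcongr
        _ = Cd * ((n : ℝ) ^ (1 : ℕ) * Real.exp (-(1 / X) * n)) := by rw [h3, pow_one]; ring
  have hDSE : ∀ t : ℝ, D t = S t + E t := by
    intro t
    simp only [hD, hS, hE]
    rw [← ((hsumm t).indicator _).tsum_add ((hsumm t).indicator _)]
    refine tsum_congr fun n ↦ ?_
    exact (Set.indicator_self_add_compl_apply (Nat.smoothNumbers P)
      (fun n ↦ c n * (n : ℂ) ^ (-((σ : ℂ) + t * I)) * (Real.exp (-(n / X)) : ℂ)) n).symm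
  have hZPsum : ∀ t : ℝ, ZP t = ∑' n : ℕ, (Nat.smoothNumbers P).indicator (fun n ↦ c n *
      (n : ℂ) ^ (-((σ : ℂ) + t * I))) n := fun t ↦
    ((hasSum_indicator_classEulerProduct χ P (s := (σ : ℂ) + t * I) (by simp; linarith)).tsum_eq).symm
  have hSZ : ∀ t : ℝ, S t - ZP t = Df t := by
    intro t
    rw [hZPsum t]
    simp only [hS, hDf]
    have h1 : Summable fun n : ℕ ↦ (Nat.smoothNumbers P).indicator (fun n ↦ c n *
        (n : ℂ) ^ (-((σ : ℂ) + t * I)) * (Real.exp (-(n / X)) : ℂ)) n := (hsumm t).indicator _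
    have h2 : Summable fun n : ℕ ↦ (Nat.smoothNumbers P).indicator (fun n ↦ c n *
        (n : ℂ) ^ (-((σ : ℂ) + t * I))) n :=
      (hasSum_indicator_classEulerProduct χ P (s := (σ : ℂ) + t * I) (by simp; linarith)).summable
    rw [← h1.tsum_sub h2]
    refine tsum_congr fun n ↦ ?_
    by_cases hn : n ∈ Nat.smoothNumbers P
    · simp only [Set.indicator_of_mem hn]; ring
    · simp only [Set.indicator_of_notMem hn, sub_zero]
  have hid : ∀ t : ℝ, D t = Lf t + Pole t + Rint t := by
    intro t
    exact smoothedSum_eq (K := K) a ha (s := (σ : ℂ) + t * I) (by simp; linarith)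
      (by simp; linarith) ha'0 ha'1 (by simp [ha']; linarith) (by simp [ha']; linarith) hX0
  have hmain_id : ∀ t : ℝ, Lf t - ZP t = Df t + E t - Pole t - Rint t := by
    intro t
    have h1 := hid t; have h2 := hDSE t; have h3 := hSZ t
    linear_combination -h1 + h2 + h3
  -- ### continuity
  have hLfc : Continuous Lf := continuous_classTwistedZeta_vertical (K := K) a (z₀ := σ) (by simp; linarith)
  have hZPc : Continuous ZP := continuous_classEulerProduct_vertical χ P (by linarith : 0 < σ)
  have hDc : Continuous D := by rw [hD, hc]; exact continuous_smoothedSum (K := K) ha (by linarith) hX0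
  have hSc : Continuous S := by
    rw [hS, hc]; exact continuous_maskedSum (K := K) ha _ (by linarith) hX0
  have hEc : Continuous E := by
    rw [hE, hc]; exact continuous_maskedSum (K := K) ha _ (by linarith) hX0
  have hPolec : Continuous Pole := continuous_poleTerm (K := K) a (by linarith) hX0
  have hDfc : Continuous Df := by
    have : Df = fun t ↦ S t - ZP t := funext fun t ↦ (hSZ t).symm
    rw [this]; exact hSc.sub hZPc
  have hRintc : Continuous Rint := by
    have : Rint = fun t ↦ D t - Lf t - Pole t := funext fun t ↦ by rw [hid t]; ring
    rw [this]; exact (hDc.sub hLfc).sub hPolec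
  -- ### pointwise and integrated splitting
  have hpt : ∀ t : ℝ, ‖Lf t - ZP t‖ ^ 2 ≤
      4 * (‖Df t‖ ^ 2 + ‖E t‖ ^ 2 + ‖Pole t‖ ^ 2 + ‖Rint t‖ ^ 2) := by
    intro t; rw [hmain_id t]; exact ClassEulerProduct.norm_add_sub_sub_sq_le _ _ _ _
  have iL : IntervalIntegrable (fun t : ℝ ↦ ‖Lf t - ZP t‖ ^ 2) volume (-T) T :=
    ((hLfc.sub hZPc).norm.pow 2).intervalIntegrable (μ := volume) _ _
  have iDf : IntervalIntegrable (fun t : ℝ ↦ ‖Df t‖ ^ 2) volume (-T) T :=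
    (hDfc.norm.pow 2).intervalIntegrable (μ := volume) _ _
  have iE : IntervalIntegrable (fun t : ℝ ↦ ‖E t‖ ^ 2) volume (-T) T :=
    (hEc.norm.pow 2).intervalIntegrable (μ := volume) _ _
  have iP : IntervalIntegrable (fun t : ℝ ↦ ‖Pole t‖ ^ 2) volume (-T) T :=
    (hPolec.norm.pow 2).intervalIntegrable (μ := volume) _ _
  have iR : IntervalIntegrable (fun t : ℝ ↦ ‖Rint t‖ ^ 2) volume (-T) T :=
    (hRintc.norm.pow 2).intervalIntegrable (μ := volume) _ _
  have hIZ := intervalIntegral.integral_mono_on hTT iL ((((iDf.add iE).add iP).add iR).const_mul 4)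
    (fun t _ ↦ hpt t)
  have hsplit : ∫ t in (-T)..T, 4 * (‖Df t‖ ^ 2 + ‖E t‖ ^ 2 + ‖Pole t‖ ^ 2 + ‖Rint t‖ ^ 2) =
      4 * ((∫ t in (-T)..T, ‖Df t‖ ^ 2) + (∫ t in (-T)..T, ‖E t‖ ^ 2) +
        (∫ t in (-T)..T, ‖Pole t‖ ^ 2) + ∫ t in (-T)..T, ‖Rint t‖ ^ 2) := by
    rw [intervalIntegral.integral_const_mul, intervalIntegral.integral_add ((iDf.add iE).add iP) iR,
      intervalIntegral.integral_add (iDf.add iE) iP, intervalIntegral.integral_add iDf iE]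
  -- ### the four bounds
  have hDfb : ∫ t in (-T)..T, ‖Df t‖ ^ 2 ≤ ε / 20 * T := by
    have hpt' : ∀ t ∈ Icc (-T) T, ‖Df t‖ ^ 2 ≤ δ₁ ^ 2 := fun t _ ↦
      pow_le_pow_left₀ (norm_nonneg _) (hX₀ X hXX₀ σ hσ1 t) 2
    calc ∫ t in (-T)..T, ‖Df t‖ ^ 2 ≤ ∫ t in (-T)..T, δ₁ ^ 2 :=
          intervalIntegral.integral_mono_on hTT iDf intervalIntegrable_const hpt'
      _ = 2 * T * δ₁ ^ 2 := by rw [intervalIntegral.integral_const, smul_eq_mul]; ring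
      _ ≤ 2 * T * (ε / 40) := by gcongr
      _ = ε / 20 * T := by ring
  have hEb : ∫ t in (-T)..T, ‖E t‖ ^ 2 ≤ ε / 10 * T := by
    have h := hCE (Nat.smoothNumbers P)ᶜ a ha σ X T hσ1 hX1 hT1
    have hXe : X ^ (2 - 2 * σ₁ + 2 * ε₀) ≤ X := by
      calc X ^ (2 - 2 * σ₁ + 2 * ε₀) ≤ X ^ (1 : ℝ) :=
            Real.rpow_le_rpow_of_exponent_le hX1 (by rw [hε₀]; linarith)
        _ = X := Real.rpow_one X
    have h1 : CE * (T * ∑' n : ℕ, (Nat.smoothNumbers P)ᶜ.indicator (fun n ↦ (n : ℝ) ^ (-pE)) n) ≤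
        ε / 20 * T := by
      calc CE * (T * ∑' n : ℕ, (Nat.smoothNumbers P)ᶜ.indicator (fun n ↦ (n : ℝ) ^ (-pE)) n)
          ≤ CE * (T * (ε / 20 / CE)) := by gcongr
        _ = ε / 20 * T := by field_simp
    have h2 : CE * X ^ (2 - 2 * σ₁ + 2 * ε₀) ≤ ε / 20 * T := by
      have hth := ClassEulerProduct.mul_rpow_le_of_threshold (C := 4 * CE) (δ := ε / 20)
        (θ := 3 / 19) (by positivity) (by positivity) (by norm_num) hT1 hTE
      have hpos : 0 ≤ ε / 20 * T := by positivity
      calc CE * X ^ (2 - 2 * σ₁ + 2 * ε₀) ≤ CE * X := by gcongr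
        _ = CE * T ^ (3 / 19 : ℝ) := by rw [hX]
        _ ≤ ε / 20 * T := by linarith
    have hp' : -(2 * σ₁ - 2 * ε₀) = -pE := by rw [hpE]
    rw [hp'] at h
    calc ∫ t in (-T)..T, ‖E t‖ ^ 2
        ≤ CE * (T * (∑' n : ℕ, (Nat.smoothNumbers P)ᶜ.indicator (fun n ↦ (n : ℝ) ^ (-pE)) n) +
            X ^ (2 - 2 * σ₁ + 2 * ε₀)) := h
      _ = CE * (T * ∑' n : ℕ, (Nat.smoothNumbers P)ᶜ.indicator (fun n ↦ (n : ℝ) ^ (-pE)) n) +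
            CE * X ^ (2 - 2 * σ₁ + 2 * ε₀) := by ring
      _ ≤ ε / 20 * T + ε / 20 * T := add_le_add h1 h2
      _ = ε / 10 * T := by ring
  have hPb : ∫ t in (-T)..T, ‖Pole t‖ ^ 2 ≤ ε / 20 * T := by
    have h := hCP a ha σ (by linarith) hσ2 X hX0 T hT0
    have hXe : X ^ (2 - 2 * σ) ≤ X := by
      calc X ^ (2 - 2 * σ) ≤ X ^ (1 : ℝ) := Real.rpow_le_rpow_of_exponent_le hX1 (by linarith)
        _ = X := Real.rpow_one X
    have hth := ClassEulerProduct.mul_rpow_le_of_threshold (C := 4 * CP) (δ := ε / 20)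
      (θ := 3 / 19) (by positivity) (by positivity) (by norm_num) hT1 hTP
    have hpos : 0 ≤ ε / 20 * T := by positivity
    calc ∫ t in (-T)..T, ‖Pole t‖ ^ 2 ≤ CP * X ^ (2 - 2 * σ) := h
      _ ≤ CP * X := by gcongr
      _ = CP * T ^ (3 / 19 : ℝ) := by rw [hX]
      _ ≤ ε / 20 * T := by linarith
  have hRb : ∫ t in (-T)..T, ‖Rint t‖ ^ 2 ≤ ε / 20 * T := by
    have h := hC₃ a ha a' X T (by rw [ha']; linarith) (by rw [ha']; linarith) hX0 hT1
    simp_rw [hs] at h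
    -- `X^{-2a'} T^q ≤ T^{1 - 2η}`
    have hexp : X ^ (-(2 * a')) * T ^ q ≤ T ^ (1 - 2 * η) := by
      rw [hX, ← Real.rpow_mul hT0.le, ← Real.rpow_add hT0]
      refine Real.rpow_le_rpow_of_exponent_le hT1 ?_
      have ha'ge : 19 * η ≤ a' := by rw [ha', ← hσ₁σ']; linarith
      rw [hq1]; nlinarith
    have hth := ClassEulerProduct.mul_rpow_le_of_threshold (C := 4 * C₃) (δ := ε / 20)
      (θ := 1 - 2 * η) (by positivity) (by positivity) (by linarith) hT1 hTR
    have hpos : 0 ≤ ε / 20 * T := by positivity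
    calc ∫ t in (-T)..T, ‖Rint t‖ ^ 2 ≤ C₃ * X ^ (-(2 * a')) * T ^ q := h
      _ = C₃ * (X ^ (-(2 * a')) * T ^ q) := by ring
      _ ≤ C₃ * T ^ (1 - 2 * η) := by gcongr
      _ ≤ ε / 20 * T := by linarith
  -- ### conclusion
  have hint_eq : ∫ t in (-T)..T, ‖classGroupLFunction K χ (σ + t * I) -
      classEulerProduct K χ P (σ + t * I)‖ ^ 2 = ∫ t in (-T)..T, ‖Lf t - ZP t‖ ^ 2 := by
    refine intervalIntegral.integral_congr fun t _ ↦ ?_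
    simp only [hLf t]
    rfl
  rw [hint_eq]
  calc ∫ t in (-T)..T, ‖Lf t - ZP t‖ ^ 2
      ≤ ∫ t in (-T)..T, 4 * (‖Df t‖ ^ 2 + ‖E t‖ ^ 2 + ‖Pole t‖ ^ 2 + ‖Rint t‖ ^ 2) := hIZ
    _ = 4 * ((∫ t in (-T)..T, ‖Df t‖ ^ 2) + (∫ t in (-T)..T, ‖E t‖ ^ 2) +
        (∫ t in (-T)..T, ‖Pole t‖ ^ 2) + ∫ t in (-T)..T, ‖Rint t‖ ^ 2) := hsplit
    _ ≤ 4 * (ε / 20 * T + ε / 10 * T + ε / 20 * T + ε / 20 * T) := by gcongr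
    _ = ε * T := by ring

/-- **Finite Euler products approximate `L(s, χ)` in mean square, with bounded imaginary shifts**
(the shape of the tree's `CharEulerProductMeanSquare.LFunction_sub_finiteEulerProduct_meanSquare_uniform`
for Dirichlet `L`-functions): for `1/2 < σ₁ ≤ σ₂ < 1`, `A ≥ 0`, `ε > 0` there is `P₀` such that for
all `P ≥ P₀` there is `T₀` with
`∫₀ᵀ |L(σ + i(t+b), χ) − Z_P(σ + i(t+b), χ)|² dt ≤ ε T` for `T ≥ T₀`, `σ ∈ [σ₁, σ₂]`, `|b| ≤ A`
(substitute `u = t + b` in the symmetric statement on `[−(T+A), T+A]`).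
[cite: Steuding2007, Thm. 1.10 (proof, mean-square step) and Cor. 6.11] -/
theorem classGroupLFunction_sub_classEulerProduct_meanSquare (h2 : Module.finrank ℚ K = 2)
    (hd : NumberField.discr K < 0) (χ : ClassGroup (𝓞 K) →* ℂˣ) {σ₁ σ₂ A ε : ℝ}
    (hσ₁ : 1 / 2 < σ₁) (hσ₁₂ : σ₁ ≤ σ₂) (hσ₂ : σ₂ < 1) (hA : 0 ≤ A) (hε : 0 < ε) :
    ∃ P₀ : ℕ, ∀ P : ℕ, P₀ ≤ P → ∃ T₀ : ℝ, ∀ T : ℝ, T₀ ≤ T →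
      ∀ σ : ℝ, σ₁ ≤ σ → σ ≤ σ₂ → ∀ b : ℝ, |b| ≤ A →
        ∫ t in (0 : ℝ)..T, ‖classGroupLFunction K χ (σ + (t + b) * I) -
          classEulerProduct K χ P (σ + (t + b) * I)‖ ^ 2 ≤ ε * T := by
  obtain ⟨P₀, hP₀⟩ := classGroupLFunction_sub_classEulerProduct_meanSquare_sym h2 hd χ hσ₁ hσ₁₂ hσ₂
    (ε := ε / 2) (by positivity)
  refine ⟨P₀, fun P hP ↦ ?_⟩
  obtain ⟨T₁, hT₁1, hT₁⟩ := hP₀ P hP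
  refine ⟨max T₁ A, fun T hT σ hσ1 hσ2 b hb ↦ ?_⟩
  have hTT₁ : T₁ ≤ T := le_trans (le_max_left _ _) hT
  have hTA : A ≤ T := le_trans (le_max_right _ _) hT
  have hT0 : 0 ≤ T := le_trans hA hTA
  set F : ℝ → ℝ := fun u ↦ ‖classGroupLFunction K χ (σ + u * I) -
    classEulerProduct K χ P (σ + u * I)‖ ^ 2 with hF
  have hshift : ∫ t in (0 : ℝ)..T, ‖classGroupLFunction K χ (σ + (t + b) * I) -
      classEulerProduct K χ P (σ + (t + b) * I)‖ ^ 2 = ∫ u in (0 + b)..(T + b), F u := by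
    rw [← intervalIntegral.integral_comp_add_right F b]
    refine intervalIntegral.integral_congr fun t _ ↦ ?_
    simp only [hF]; push_cast; ring_nf
  rw [hshift]
  have hcont : Continuous F := by
    have h1 := continuous_classTwistedZeta_vertical (K := K) (fun C ↦ (χ C : ℂ)) (z₀ := σ)
      (by simp; linarith)
    have h2 := continuous_classEulerProduct_vertical χ P (by linarith : 0 < σ)
    simp only [hF, classGroupLFunction_eq_classTwistedZeta]
    exact ((h1.sub h2).norm).pow 2
  have habs : b ≤ A ∧ -A ≤ b := ⟨le_trans (le_abs_self b) hb, by linarith [neg_abs_le b]⟩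
  have hmono : ∫ u in (0 + b)..(T + b), F u ≤ ∫ u in (-(T + A))..(T + A), F u := by
    refine intervalIntegral.integral_mono_interval (by linarith) (by linarith) (by linarith)
      (Eventually.of_forall fun u ↦ sq_nonneg _) (hcont.intervalIntegrable (μ := volume) _ _)
  have hsym := hT₁ (T + A) (by linarith) σ hσ1 hσ2
  calc ∫ u in (0 + b)..(T + b), F u ≤ ∫ u in (-(T + A))..(T + A), F u := hmono
    _ ≤ ε / 2 * (T + A) := hsym
    _ ≤ ε / 2 * (T + T) := by gcongr
    _ = ε * T := by ring

end Literature.NumberTheory.LFunctions.NumberField
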